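import Summits.CriticalPhenomena.PercolationContinuityZ3.Theorems.PercNearOneGluingNoHeavyLowerTailSunflowerMultiPetalKempeNormalForm
import Mathlib.Combinatorics.SimpleGraph.Acyclic
import HarnessLib
import HarnessLib.Audit

/-!
# `NoHeavyLowerTail` (crux stmt-CriticalPhenomena-4575), Lemma B for graph clutters: the CONNECTED REDUCTION —
# one-point monotonicity of `Q` at a non-cut vertex of a CONNECTED graph implies Lemma B for every connected graph

Support file (seat `prim-l12-p2` gen 40; `--supports stmt-CriticalPhenomena-4575`; companion of `…SunflowerMultiPetalKempeNormalForm`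
(p408427: the colouring-language functional `Qcol`)).  No `sorry`; nothing is asserted about the crux; the `@[conjecture]` definition is an
obligation of the programme, never a fact.  Memo: run/shared/lean/prim/prim-l12/prim-l12-p2/FINDING-g40-KEMPE-IDENTITY-LEAN-AND-CONNECTED-SLACK.md §2.

WHY THE CONNECTED FORM.  Every tight or near-tight instance of the Lemma-B functional and of its inductive handles is DISCONNECTED:
`Q(sK₂) = 0` for `s ≤ 3`, `Q(4K₂)` has ratio `1.004`, the vertex-identification inequality CN is an equality on `P₃ ⊔ 2K₂`, and the
one-point inequality `Q(G − x) ≤ Q(G)` (census-clean at every vertex of every graph on ≤ 9 vertices, memo FINDING-g36 §2) is tight at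
matchings.  Disjoint unions are handled by THEOREM A (`…SunflowerMultiPetalTypeUnion.lemmaB_pair_nonneg`, in the tree), so only CONNECTED
graphs need an inductive argument — and there the census shows uniform slack (exact enumeration, this gen): over all connected graphs on
≤ 8 vertices and all vertices `x` with `G − x` connected (89 315 instances), `(2·POS(G) + NEG(G−x)) / (NEG(G) + 2·POS(G−x)) ≥ 1.22`
(smallest values at `K₆`, 1.26, and `K₈` minus a perfect matching, 1.22), and the kernel ratio `ΣK⁺/ΣK⁻ ≥ 2.45` at vertices of degree ≥ 2 (n ≤ 7); the vertex-identification sector ratio is `≥ 1.5` (minimum `K₅ − e`), against `1`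
for disconnected graphs.  This file records the connected one-point form as a typed obligation and proves that it ALONE gives Lemma B for
every connected graph (peel a non-cut vertex — a leaf of a spanning tree, `SimpleGraph.Connected.exists_connected_induce_compl_singleton_of_finite_nontrivial`).

* `MZQConnected` (OPEN, census-clean): `Qcol (G − x) ≤ Qcol G` for connected `G` and `x` with `G − x` connected.
* `Qcol_nonneg_of_connected` : `MZQConnected →` every connected finite graph has `0 ≤ Qcol G`.
-/

namespace Summit.CriticalPhenomena.PercolationContinuityZ3.Theorems.SunflowerPartition.Kempe

open Finset
open scoped Classical

/-- **ONE-POINT MONOTONICITY OF `Q` AT A NON-CUT VERTEX OF A CONNECTED GRAPH** (this work; OPEN; evidence in the file header: 0 violations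
over all (graph, vertex) pairs on ≤ 9 vertices, ratio ≥ 1.22 over all connected instances on ≤ 8 vertices): for a connected finite graph `G`
and a vertex `x` whose deletion leaves `G` connected, `Q(G − x) ≤ Q(G)`.  An obligation, never a fact: use as `(h : MZQConnected)`.
[status: open] -/
@[conjecture] def MZQConnected : Prop :=
  ∀ (V : Type) [Fintype V] (G : SimpleGraph V) (x : V), G.Connected → (G.induce ({x}ᶜ : Set V)).Connected →
    Qcol (G.induce ({x}ᶜ : Set V)) ≤ Qcol G

variable {V : Type*} [Fintype V] (G : SimpleGraph V)

/-- A graph on at most one vertex has no edges, hence no monochromatic edges. [this work] -/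
theorem cnt_eq_zero_of_subsingleton [Subsingleton V] (σ : V → Fin 3) (c : Fin 3) : cnt G σ c = 0 := by
  unfold cnt monoCol
  rw [Finset.card_eq_zero, filter_eq_empty_iff]
  intro e he
  rw [mem_edges] at he
  induction e using Sym2.ind with
  | _ u v => exact absurd (Subsingleton.elim u v) (G.ne_of_adj ((mk_mem_edgeSet_iff G u v).1 he))

/-- A graph on at most one vertex has `Q = 0`. [this work] -/
theorem Qcol_eq_zero_of_subsingleton [Subsingleton V] : Qcol G = 0 := by
  unfold Qcol
  refine sum_eq_zero fun σ _ => ?_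
  have h0 : ∀ c, cnt G σ c = 0 := cnt_eq_zero_of_subsingleton G σ
  unfold qcol IsPos IsNeg
  rw [if_neg, if_neg, sub_zero]
  · rintro (⟨c, -, hc⟩ | h)
    · obtain ⟨c', hc'⟩ : ∃ c' : Fin 3, c' ≠ c := ⟨c + 1, by
        intro h; have := congrArg (fun z : Fin 3 => z - c) h; simp at this⟩
      have := hc c' hc'; rw [h0] at this; exact absurd this (by decide)
    · have := h 0; rw [h0] at this; exact absurd this (by decide)
  · rintro ⟨c, hc, -⟩; rw [h0] at hc; exact absurd hc (by decide)

/-- **THE CONNECTED REDUCTION**: one-point monotonicity at non-cut vertices of connected graphs gives Lemma B for every connected finite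
graph (induction on the number of vertices, peeling a vertex whose deletion keeps the graph connected). [this work] -/
theorem Qcol_nonneg_of_connected (h : MZQConnected) :
    ∀ (n : ℕ) (W : Type) [Fintype W] (H : SimpleGraph W), Fintype.card W = n → H.Connected → 0 ≤ Qcol H := by
  intro n
  induction n using Nat.strong_induction_on with
  | _ n ih =>
    intro W _ H hcard hconn
    by_cases hn : n ≤ 1
    · haveI : Subsingleton W := Fintype.card_le_one_iff_subsingleton.mp (hcard ▸ hn)
      rw [Qcol_eq_zero_of_subsingleton]
    · haveI : Nontrivial W := Fintype.one_lt_card_iff_nontrivial.mp (by omega)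
      obtain ⟨x, hx⟩ := hconn.exists_connected_induce_compl_singleton_of_finite_nontrivial
      have hle := h W H x hconn hx
      have hcard' : Fintype.card ↥({x}ᶜ : Set W) = n - 1 := by
        rw [Fintype.card_compl_set, Set.card_singleton, hcard]
      have h0 := ih (n - 1) (by omega) ↥({x}ᶜ : Set W) (H.induce ({x}ᶜ : Set W)) hcard' hx
      exact le_trans h0 hle

/-- Corollary, unparametrised: under `MZQConnected` every connected finite graph satisfies Lemma B in colouring language. [this work] -/
theorem Qcol_nonneg_of_connected' (h : MZQConnected) {W : Type} [Fintype W] (H : SimpleGraph W) (hconn : H.Connected) :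
    0 ≤ Qcol H :=
  Qcol_nonneg_of_connected h _ W H rfl hconn

end Summit.CriticalPhenomena.PercolationContinuityZ3.Theorems.SunflowerPartition.Kempe
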